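import Summits.Parity.GeneralizedHardyLittlewood.Theorems.GreenTaoLevelTwoGITwoCyclicInverseBohrRegularPrelims
import Mathlib.Analysis.Complex.ExponentialBounds

/-!
# Route `GreenTaoLevelTwo`, crux `GITwo` (stmt-Parity-21275), line `birth`, stub `stub_cyclicInverse`:
# regular Bohr sets are ubiquitous (GT08a arXiv Lemma 36, Bourgain)

Twenty-third helper file toward the XL stub `stub_cyclicInverse` (B. Green, T. Tao, *An inverse
theorem for the Gowers `U³(G)` norm*, arXiv:math/0503014, Thm. 68 = PEMS 51 (2008) Thm. 12.8).
Block B5 of the printed proof, arXiv Lemma 36: for every `S ⊆ ℤ/Nℤ` (`d = #S`) and `ε > 0` there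
is `ρ ∈ [ε, 2ε]` with `B(S, ρ)` REGULAR in the sense of arXiv Def. 16,
`(1 − 100d|κ|) #B(S,ρ) ≤ #B(S,(1+κ)ρ) ≤ (1 + 100d|κ|) #B(S,ρ)` for `|κ| ≤ 1/(100d)` — the
hypothesis of every averaging / local Fourier statement of §§8–10 of the paper (arXiv Lemmas 38–42,
Props. 43, 45, Thm. 17).  Bohr sets are spelled def-free through `ZMod.toAddCircle` as in the
sibling files.

The paper argues with the Vitali covering lemma for `a ↦ log #B(S, 2^a ε)`; we give a DISCRETE
proof of the same statement with the same constant `100`: on the grid `t_k = k h`, `h = log 2 / n`,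
`n = 4N + 4`, with `φ(k) = log #B(S, ε e^{t_k})` (total variation `≤ d log 4` by the doubling bound
`card_bohr_two_mul_le`), the right-bad grid points (`φ(j) − φ(k) > K h (j − k)` for some `j > k`,
`K = 25d`) and the left-bad ones are each at most `(φ(n) − φ(0))/(Kh) ≤ 2n/25` in number
(`card_filter_Icc_le_of_forall_exists_gt/lt`), the grid points within one step of one of the
critical levels `log(max_ξ ‖xξ‖/ε)/h` (`x ∈ ℤ/Nℤ`) are at most `2N`, and the two margins cost
`2⌈1/(50 d h)⌉ ≤ 2n/25 + 2`; so a good grid point `k` exists, and at `ρ = ε e^{t_k}` local constancy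
(no critical level nearby) plus the two one-sided grid-Lipschitz bounds give the exponential-scale
control of `regular_of_exp_control`, hence regularity.

* `exists_regular_bohr` — **arXiv Lemma 36**: `∃ ρ ∈ [ε, 2ε]` with `B(S, ρ)` regular (Def. 16).

References: [GreenTao2008U3Inverse] arXiv:math/0503014, Def. 16 and Lemma 36; J. Bourgain, *On
triples in arithmetic progression*, GAFA 9 (1999), §3; T. Tao, V. Vu, *Additive Combinatorics*,
Lemma 4.25.
-/

noncomputable section

namespace Summit.Parity.GeneralizedHardyLittlewood.GreenTaoLevelTwoGITwoCyclicInverse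

open Finset

variable {N : ℕ} [NeZero N]

/-! ### arXiv Lemma 36 -/

/-- **Regular Bohr sets are ubiquitous (GT08a arXiv Lemma 36, after Bourgain).**  For every
`S ⊆ ℤ/Nℤ` (`d = #S`) and every `ε > 0` there is a radius `ρ ∈ [ε, 2ε]` at which the Bohr set
`B(S, ρ) = {x : ‖toAddCircle(xξ)‖ < ρ ∀ ξ ∈ S}` is regular in the sense of arXiv Def. 16:
`(1 − 100 d |κ|) #B(S,ρ) ≤ #B(S,(1+κ)ρ) ≤ (1 + 100 d |κ|) #B(S,ρ)` whenever `|κ| ≤ 1/(100 d)`.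
[cite: GreenTao2008U3Inverse, Lemma 36] -/
theorem exists_regular_bohr (S : Finset (ZMod N)) {ε : ℝ} (hε : 0 < ε) :
    ∃ ρ : ℝ, ε ≤ ρ ∧ ρ ≤ 2 * ε ∧
      ∀ κ : ℝ, |κ| ≤ 1 / (100 * (#S : ℝ)) →
        (1 - 100 * (#S : ℝ) * |κ|) * #{x : ZMod N | ∀ ξ ∈ S, ‖ZMod.toAddCircle (x * ξ)‖ < ρ} ≤
            #{x : ZMod N | ∀ ξ ∈ S, ‖ZMod.toAddCircle (x * ξ)‖ < (1 + κ) * ρ} ∧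
          (#{x : ZMod N | ∀ ξ ∈ S, ‖ZMod.toAddCircle (x * ξ)‖ < (1 + κ) * ρ} : ℝ) ≤
            (1 + 100 * (#S : ℝ) * |κ|) * #{x : ZMod N | ∀ ξ ∈ S, ‖ZMod.toAddCircle (x * ξ)‖ < ρ} := by
  classical
  -- the rank-zero case is trivial
  rcases S.eq_empty_or_nonempty with rfl | hS
  · refine ⟨ε, le_rfl, by linarith, fun κ hκ => ?_⟩
    have hκ0 : κ = 0 := by
      rw [card_empty, Nat.cast_zero, mul_zero, div_zero] at hκ
      exact abs_nonpos_iff.mp hκ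
    subst hκ0
    simp
  -- opaque names for the data of the proof
  obtain ⟨d, hd⟩ : ∃ d : ℕ, d = #S := ⟨_, rfl⟩
  have hd1 : (1 : ℝ) ≤ d := by
    rw [hd]; exact_mod_cast Nat.one_le_iff_ne_zero.mpr (card_pos.mpr hS).ne'
  have hd0 : (0 : ℝ) < d := by linarith
  obtain ⟨G, hG⟩ : ∃ G : ℝ → ℝ,
      ∀ t, G t = (#{x : ZMod N | ∀ ξ ∈ S, ‖ZMod.toAddCircle (x * ξ)‖ < t} : ℝ) :=
    ⟨_, fun _ => rfl⟩
  have hGmono : Monotone G := fun t t' htt => by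
    rw [hG, hG]; exact_mod_cast card_bohr_mono S htt
  have hG1 : ∀ t, 0 < t → 1 ≤ G t := fun t ht => by
    rw [hG]; exact_mod_cast one_le_card_bohr S ht
  -- the grid `t_k = k h`, `h = log 2 / n`, `n = 4N + 4`
  obtain ⟨n, hn⟩ : ∃ n : ℕ, n = 4 * N + 4 := ⟨_, rfl⟩
  have hn0 : (0 : ℝ) < n := by rw [hn]; positivity
  have hn0' : (n : ℝ) ≠ 0 := hn0.ne'
  have hnN : (N : ℝ) ≤ n / 4 - 1 := by rw [hn]; push_cast; linarith
  obtain ⟨h, hh⟩ : ∃ h : ℝ, h = Real.log 2 / n := ⟨_, rfl⟩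
  have hlog2 : (1 : ℝ) / 2 < Real.log 2 := lt_trans (by norm_num) Real.log_two_gt_d9
  have hh0 : 0 < h := by rw [hh]; positivity
  have hnh : (n : ℝ) * h = Real.log 2 := by rw [hh]; field_simp
  obtain ⟨r, hr⟩ : ∃ r : ℕ → ℝ, ∀ k, r k = ε * Real.exp (k * h) := ⟨_, fun _ => rfl⟩
  have hr0 : ∀ k, 0 < r k := fun k => by rw [hr]; positivity
  have hrexp : ∀ (k : ℕ) (s : ℝ), r k * Real.exp s = ε * Real.exp (k * h + s) := fun k s => by
    rw [hr, Real.exp_add]; ring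
  have hrmono : Monotone r := fun k k' hk => by
    rw [hr, hr]
    exact mul_le_mul_of_nonneg_left (Real.exp_le_exp.mpr
      (mul_le_mul_of_nonneg_right (Nat.cast_le.mpr hk) hh0.le)) hε.le
  obtain ⟨φ, hφ⟩ : ∃ φ : ℕ → ℝ, ∀ k, φ k = Real.log (G (r k)) := ⟨_, fun _ => rfl⟩
  have hφmono : Monotone φ := fun k k' hk => by
    rw [hφ, hφ]
    exact Real.log_le_log (lt_of_lt_of_le one_pos (hG1 _ (hr0 k))) (hGmono (hrmono hk))
  have hGexp : ∀ k, G (r k) = Real.exp (φ k) := fun k => by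
    rw [hφ, Real.exp_log (lt_of_lt_of_le one_pos (hG1 _ (hr0 k)))]
  -- total variation of `φ` on the grid: the doubling bound
  have hvar : φ n - φ 0 ≤ 2 * d * Real.log 2 := by
    have hr0' : r 0 = ε := by rw [hr]; simp
    have hrn : r n = 2 * ε := by rw [hr, hnh, Real.exp_log (by norm_num)]; ring
    have hdoub : G (2 * ε) ≤ (4 : ℝ) ^ d * G ε := by
      rw [hG, hG, hd]; exact_mod_cast card_bohr_two_mul_le S hε
    have hGε : 0 < G ε := lt_of_lt_of_le one_pos (hG1 ε hε)
    have hG2ε : 0 < G (2 * ε) := lt_of_lt_of_le one_pos (hG1 _ (by linarith))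
    have hlog := Real.log_le_log hG2ε hdoub
    rw [Real.log_mul (by positivity) hGε.ne', Real.log_pow,
      show (4 : ℝ) = 2 ^ 2 by norm_num, Real.log_pow] at hlog
    rw [hφ, hφ, hr0', hrn]
    push_cast at hlog
    linarith
  -- the three exceptional kinds of grid points
  obtain ⟨K, hK⟩ : ∃ K : ℝ, K = 25 * d := ⟨_, rfl⟩
  have hK0 : 0 < K * h := by rw [hK]; positivity
  have hKh : K * h * n = 25 * d * Real.log 2 := by
    rw [hK, mul_assoc, mul_comm h, hnh]
  obtain ⟨PR, hPR⟩ : ∃ PR : ℕ → Prop,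
      ∀ k, PR k ↔ ∃ j, k < j ∧ j ≤ n ∧ K * h * ((j : ℝ) - k) < φ j - φ k := ⟨_, fun _ => Iff.rfl⟩
  obtain ⟨PL, hPL⟩ : ∃ PL : ℕ → Prop,
      ∀ k, PL k ↔ ∃ j, j < k ∧ K * h * ((k : ℝ) - j) < φ k - φ j := ⟨_, fun _ => Iff.rfl⟩
  obtain ⟨m, hm⟩ : ∃ m : ZMod N → ℝ,
      ∀ x, m x = S.sup' hS fun ξ => ‖ZMod.toAddCircle (x * ξ)‖ := ⟨_, fun _ => rfl⟩
  have hmem : ∀ (x : ZMod N) (t : ℝ), (∀ ξ ∈ S, ‖ZMod.toAddCircle (x * ξ)‖ < t) ↔ m x < t :=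
    fun x t => by rw [hm, Finset.sup'_lt_iff]
  obtain ⟨c, hc⟩ : ∃ c : ZMod N → ℝ, ∀ x, c x = Real.log (m x / ε) / h := ⟨_, fun _ => rfl⟩
  obtain ⟨PC, hPC⟩ : ∃ PC : ℕ → Prop,
      ∀ k, PC k ↔ ∃ x : ZMod N, (k : ℝ) - 1 ≤ c x ∧ c x < k + 1 := ⟨_, fun _ => Iff.rfl⟩
  obtain ⟨j₀, hj₀⟩ : ∃ j₀ : ℕ, j₀ = ⌈1 / (50 * (d : ℝ)) / h⌉₊ := ⟨_, rfl⟩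
  -- between the two grid neighbours of a non-adjacent `k` there is no critical radius
  have hnocrit : ∀ k : ℕ, ¬PC k → ∀ t t' : ℝ, r k * Real.exp (-h) < t → t ≤ t' →
      t' ≤ r k * Real.exp h → G t' ≤ G t := by
    intro k hk t t' ht htt' ht'
    rw [hG, hG]
    have hlow : 0 < r k * Real.exp (-h) := mul_pos (hr0 k) (Real.exp_pos _)
    refine Nat.cast_le.mpr (card_le_card fun x hx => ?_)
    rw [mem_filter] at hx ⊢
    refine ⟨hx.1, ?_⟩
    rw [hmem] at hx ⊢
    by_contra hxt
    push Not at hxt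
    apply hk
    rw [hPC]
    refine ⟨x, ?_, ?_⟩
    · have hmx : r k * Real.exp (-h) < m x := lt_of_lt_of_le ht hxt
      have h1 : Real.log (r k * Real.exp (-h) / ε) < Real.log (m x / ε) :=
        Real.log_lt_log (div_pos hlow hε) (div_lt_div_of_pos_right hmx hε)
      have h2 : Real.log (r k * Real.exp (-h) / ε) = (k - 1) * h := by
        rw [hrexp, mul_div_cancel_left₀ _ hε.ne', Real.log_exp]; ring
      rw [hc, le_div_iff₀ hh0]; linarith
    · have hmx : m x < r k * Real.exp h := lt_of_lt_of_le hx.2 ht'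
      have hmx0 : 0 < m x := lt_of_lt_of_le (lt_trans hlow ht) hxt
      have h1 : Real.log (m x / ε) < Real.log (r k * Real.exp h / ε) :=
        Real.log_lt_log (div_pos hmx0 hε) (div_lt_div_of_pos_right hmx hε)
      have h2 : Real.log (r k * Real.exp h / ε) = (k + 1) * h := by
        rw [hrexp, mul_div_cancel_left₀ _ hε.ne', Real.log_exp]; ring
      rw [hc, div_lt_iff₀ hh0]; linarith
  -- counts
  have hR : K * h * #{k ∈ Icc 0 n | PR k} ≤ φ n - φ 0 :=
    card_filter_Icc_le_of_forall_exists_gt hφmono hK0 n PR (fun i hi _ => (hPR i).mp hi)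
      (Nat.zero_le n)
  have hLc : K * h * #{k ∈ Icc 0 n | PL k} ≤ φ n - φ 0 :=
    card_filter_Icc_le_of_forall_exists_lt hφmono hK0 PL (fun i hi => (hPL i).mp hi) n
  have hC : #{k ∈ Icc 0 n | PC k} ≤ 2 * N := by
    -- each `x` accounts for at most two grid points
    have hsub : ({k ∈ Icc 0 n | PC k} : Finset ℕ) ⊆
        (univ : Finset (ZMod N)).biUnion fun x =>
          (({⌊c x⌋, ⌊c x⌋ + 1} : Finset ℤ).image Int.toNat) := by
      intro k hk
      rw [mem_filter, hPC] at hk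
      obtain ⟨x, hx1, hx2⟩ := hk.2
      rw [mem_biUnion]
      refine ⟨x, mem_univ _, ?_⟩
      rw [mem_image]
      have h1 : (k : ℤ) - 1 ≤ ⌊c x⌋ := Int.le_floor.mpr (by push_cast; linarith)
      have h2 : ⌊c x⌋ < (k : ℤ) + 1 := Int.floor_lt.mpr (by push_cast; linarith)
      rcases eq_or_lt_of_le h1 with heq | hlt
      · refine ⟨⌊c x⌋ + 1, by simp, ?_⟩
        rw [← heq]; simp
      · refine ⟨⌊c x⌋, by simp, ?_⟩
        have : ⌊c x⌋ = k := by omega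
        rw [this]; simp
    refine (card_le_card hsub).trans (card_biUnion_le.trans ?_)
    have h2 : ∀ x ∈ (univ : Finset (ZMod N)),
        #((({⌊c x⌋, ⌊c x⌋ + 1} : Finset ℤ).image Int.toNat)) ≤ 2 :=
      fun x _ => card_image_le.trans card_le_two
    refine (sum_le_sum h2).trans ?_
    rw [sum_const, card_univ, ZMod.card, smul_eq_mul, mul_comm]
  -- a good grid point exists
  have hgood : ∃ k, k ≤ n ∧ ¬PR k ∧ ¬PL k ∧ ¬PC k ∧ j₀ ≤ k ∧ k + j₀ ≤ n := by
    by_contra hne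
    push Not at hne
    have hcover : Icc 0 n ⊆ ({k ∈ Icc 0 n | PR k} ∪ {k ∈ Icc 0 n | PL k} ∪ {k ∈ Icc 0 n | PC k}) ∪
        (range j₀ ∪ Ioc (n - j₀) n) := by
      intro k hk
      have hkn : k ≤ n := (mem_Icc.mp hk).2
      simp only [mem_union, mem_filter, mem_range, mem_Ioc]
      by_cases h1 : PR k
      · exact Or.inl (Or.inl (Or.inl ⟨hk, h1⟩))
      by_cases h2 : PL k
      · exact Or.inl (Or.inl (Or.inr ⟨hk, h2⟩))
      by_cases h3 : PC k
      · exact Or.inl (Or.inr ⟨hk, h3⟩)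
      by_cases h4 : j₀ ≤ k
      · have := hne k hkn h1 h2 h3 h4
        exact Or.inr (Or.inr ⟨by omega, hkn⟩)
      · exact Or.inr (Or.inl (not_le.mp h4))
    have hcard := (card_le_card hcover).trans
      ((card_union_le _ _).trans (add_le_add ((card_union_le _ _).trans
        (add_le_add (card_union_le _ _) le_rfl)) (card_union_le _ _)))
    rw [Nat.card_Icc, card_range, Nat.card_Ioc, Nat.sub_zero] at hcard
    have hcardR : ((n + 1 : ℕ) : ℝ) ≤
        ((#{k ∈ Icc 0 n | PR k} + #{k ∈ Icc 0 n | PL k} + #{k ∈ Icc 0 n | PC k}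
          + (j₀ + (n - (n - j₀))) : ℕ) : ℝ) := by exact_mod_cast hcard
    have hj : ((n - (n - j₀) : ℕ) : ℝ) ≤ j₀ := by
      exact_mod_cast (by omega : n - (n - j₀) ≤ j₀)
    push_cast at hcardR
    -- the individual bounds
    have e1 : (#{k ∈ Icc 0 n | PR k} : ℝ) * 25 ≤ 2 * n := by
      have h' := hR.trans hvar
      refine le_of_mul_le_mul_right ?_ hK0
      calc (#{k ∈ Icc 0 n | PR k} : ℝ) * 25 * (K * h) = 25 * (K * h * #{k ∈ Icc 0 n | PR k}) := by
            ring
        _ ≤ 25 * (2 * d * Real.log 2) := by linarith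
        _ = 2 * n * (K * h) := by linear_combination (-2 : ℝ) * hKh
    have e2 : (#{k ∈ Icc 0 n | PL k} : ℝ) * 25 ≤ 2 * n := by
      have h' := hLc.trans hvar
      refine le_of_mul_le_mul_right ?_ hK0
      calc (#{k ∈ Icc 0 n | PL k} : ℝ) * 25 * (K * h) = 25 * (K * h * #{k ∈ Icc 0 n | PL k}) := by
            ring
        _ ≤ 25 * (2 * d * Real.log 2) := by linarith
        _ = 2 * n * (K * h) := by linear_combination (-2 : ℝ) * hKh
    have e3 : (#{k ∈ Icc 0 n | PC k} : ℝ) ≤ 2 * N := by exact_mod_cast hC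
    have e5 : (j₀ : ℝ) ≤ n / 25 + 1 := by
      have hc' := Nat.ceil_lt_add_one (show 0 ≤ 1 / (50 * (d : ℝ)) / h by positivity)
      have hq : 1 / (50 * (d : ℝ)) / h ≤ n / 25 := by
        rw [hh, div_div, div_le_div_iff₀ (by positivity) (by norm_num)]
        have : (n : ℝ) * (50 * (d : ℝ) * (Real.log 2 / n)) = 50 * (d * Real.log 2) := by
          field_simp
        rw [this]
        have hprod := mul_le_mul hd1 hlog2.le (by norm_num) hd0.le
        linarith
      rw [hj₀]
      linarith
    linarith
  -- a good grid point `k`; the radius is `ρ = r k = ε e^{k h}`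
  obtain ⟨k, hkn, hPRk, hPLk, hPCk, hk1, hk2⟩ := hgood
  have hρ0 : 0 < r k := hr0 k
  have hGk0 : 0 ≤ G (r k) := by linarith [hG1 _ hρ0]
  -- integer steps covering a scale `s ∈ [h, 1/(50 d)]`
  have hjj : ∀ s : ℝ, h ≤ s → s ≤ 1 / (50 * (d : ℝ)) →
      ∃ jj : ℕ, 1 ≤ jj ∧ jj ≤ j₀ ∧ s ≤ jj * h ∧ (jj : ℝ) * h ≤ 2 * s := by
    intro s hs1 hs2
    have hs0 : 0 < s := lt_of_lt_of_le hh0 hs1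
    refine ⟨⌈s / h⌉₊, Nat.one_le_iff_ne_zero.mpr (Nat.ceil_pos.mpr (by positivity)).ne', ?_, ?_, ?_⟩
    · rw [hj₀]; exact Nat.ceil_mono (div_le_div_of_nonneg_right hs2 hh0.le)
    · have := Nat.le_ceil (s / h)
      rwa [div_le_iff₀ hh0] at this
    · have h1 := Nat.ceil_lt_add_one (show 0 ≤ s / h by positivity)
      have h2 : (⌈s / h⌉₊ : ℝ) * h < (s / h + 1) * h := mul_lt_mul_of_pos_right h1 hh0
      rw [add_mul, div_mul_cancel₀ _ hh0.ne', one_mul] at h2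
      linarith
  -- upper control `G(ρ e^s) ≤ e^{50 d s} G(ρ)`
  have hU : ∀ s : ℝ, 0 ≤ s → s ≤ 1 / (50 * (d : ℝ)) →
      G (r k * Real.exp s) ≤ Real.exp (50 * d * s) * G (r k) := by
    intro s hs0 hs1
    rcases lt_or_ge s h with hsh | hsh
    · have h1 : G (r k * Real.exp s) ≤ G (r k) :=
        hnocrit k hPCk (r k) (r k * Real.exp s)
          (mul_lt_of_lt_one_right hρ0 (Real.exp_lt_one_iff.mpr (by linarith)))
          (le_mul_of_one_le_right hρ0.le (Real.one_le_exp hs0))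
          (mul_le_mul_of_nonneg_left (Real.exp_le_exp.mpr hsh.le) hρ0.le)
      calc G (r k * Real.exp s) ≤ G (r k) := h1
        _ = 1 * G (r k) := (one_mul _).symm
        _ ≤ Real.exp (50 * d * s) * G (r k) :=
            mul_le_mul_of_nonneg_right (Real.one_le_exp (by positivity)) hGk0
    · obtain ⟨jj, hjj1, hjj2, hjj3, hjj4⟩ := hjj s hsh hs1
      have hjn : k + jj ≤ n := by omega
      have hφj : φ (k + jj) - φ k ≤ K * h * (((k + jj : ℕ) : ℝ) - k) :=
        le_of_not_gt fun hcon => hPRk ((hPR k).mpr ⟨k + jj, by omega, hjn, hcon⟩)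
      push_cast at hφj
      have h1 : G (r k * Real.exp s) ≤ G (r (k + jj)) := hGmono (by
        rw [hrexp, hr]; push_cast
        exact mul_le_mul_of_nonneg_left (Real.exp_le_exp.mpr
          (by linarith [hjj3, show ((k : ℝ) + jj) * h = k * h + jj * h by ring])) hε.le)
      have h2 : G (r (k + jj)) ≤ Real.exp (50 * d * s) * G (r k) := by
        rw [hGexp, hGexp, ← Real.exp_add]
        apply Real.exp_le_exp.mpr
        have h3 : K * h * ((k : ℝ) + jj - k) ≤ 50 * d * s := by
          rw [hK]
          have : (25 : ℝ) * d * h * ((k : ℝ) + jj - k) = 25 * d * (jj * h) := by ring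
          rw [this]
          have h25 : (0 : ℝ) ≤ 25 * d := by positivity
          have := mul_le_mul_of_nonneg_left hjj4 h25
          linarith
        linarith
      exact h1.trans h2
  -- lower control `e^{-50 d s} G(ρ) ≤ G(ρ e^{-s})`
  have hL : ∀ s : ℝ, 0 ≤ s → s ≤ 1 / (50 * (d : ℝ)) →
      Real.exp (-(50 * d * s)) * G (r k) ≤ G (r k * Real.exp (-s)) := by
    intro s hs0 hs1
    rcases lt_or_ge s h with hsh | hsh
    · have h1 : G (r k) ≤ G (r k * Real.exp (-s)) :=
        hnocrit k hPCk (r k * Real.exp (-s)) (r k)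
          (mul_lt_mul_of_pos_left (Real.exp_lt_exp.mpr (by linarith)) hρ0)
          (mul_le_of_le_one_right hρ0.le (Real.exp_le_one_iff.mpr (by linarith)))
          (le_mul_of_one_le_right hρ0.le (Real.one_le_exp hh0.le))
      calc Real.exp (-(50 * d * s)) * G (r k) ≤ 1 * G (r k) :=
            mul_le_mul_of_nonneg_right (Real.exp_le_one_iff.mpr (by
              have : 0 ≤ 50 * (d : ℝ) * s := by positivity
              linarith)) hGk0
        _ = G (r k) := one_mul _
        _ ≤ G (r k * Real.exp (-s)) := h1
    · obtain ⟨jj, hjj1, hjj2, hjj3, hjj4⟩ := hjj s hsh hs1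
      obtain ⟨j, hjk⟩ : ∃ j : ℕ, k = j + jj := ⟨k - jj, by omega⟩
      have hkj : (k : ℝ) - j = jj := by rw [hjk]; push_cast; ring
      have hφj : φ k - φ j ≤ K * h * ((k : ℝ) - j) :=
        le_of_not_gt fun hcon => hPLk ((hPL k).mpr ⟨j, by omega, hcon⟩)
      rw [hkj] at hφj
      have h1 : G (r j) ≤ G (r k * Real.exp (-s)) := hGmono (by
        rw [hrexp, hr]
        refine mul_le_mul_of_nonneg_left (Real.exp_le_exp.mpr ?_) hε.le
        have : (k : ℝ) * h = j * h + jj * h := by rw [hjk]; push_cast; ring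
        linarith [hjj3])
      have h2 : Real.exp (-(50 * d * s)) * G (r k) ≤ G (r j) := by
        rw [hGexp, hGexp, ← Real.exp_add]
        apply Real.exp_le_exp.mpr
        have h3 : K * h * (jj : ℝ) ≤ 50 * d * s := by
          rw [hK]
          have : (25 : ℝ) * d * h * (jj : ℝ) = 25 * d * (jj * h) := by ring
          rw [this]
          have h25 : (0 : ℝ) ≤ 25 * d := by positivity
          have := mul_le_mul_of_nonneg_left hjj4 h25
          linarith
        linarith
      exact h2.trans h1
  -- conclusion
  refine ⟨r k, ?_, ?_, fun κ hκ => ?_⟩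
  · rw [hr]
    exact le_mul_of_one_le_right hε.le (Real.one_le_exp (by positivity))
  · rw [hr]
    have h2 : Real.exp (k * h) ≤ 2 := by
      calc Real.exp (k * h) ≤ Real.exp (n * h) :=
            Real.exp_le_exp.mpr (mul_le_mul_of_nonneg_right (Nat.cast_le.mpr hkn) hh0.le)
        _ = 2 := by rw [hnh, Real.exp_log (by norm_num)]
    have := mul_le_mul_of_nonneg_left h2 hε.le
    linarith
  · have hκ' : |κ| ≤ 1 / (100 * (d : ℝ)) := by rw [hd]; exact hκ
    have := regular_of_exp_control hGmono hρ0 hd1 hGk0 hU hL hκ'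
    rw [hG, hG, hd] at this
    exact this

end Summit.Parity.GeneralizedHardyLittlewood.GreenTaoLevelTwoGITwoCyclicInverse
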